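import Summits.NavierStokesRegularity.FluidComputer.ClayBlowupSlabIntegrability
import Literature.Analysis.FluidPDE.LerayFarFieldEpsilonRegularitySlabForced
import HarnessLib

/-!
# THE SINGULARITY OF A CLAY BLOW-UP CANNOT ESCAPE TO SPATIAL INFINITY:
# far-field regularity up to the lifespan, and `ClayBlowup ν → DesignedBlowup ν`

Cell `ns-blowup`, seat `ns-blowup-ecbridge-2` (g6; the E–C endpoint theory seat). LABEL: E–C typing
(KERNEL — no named fact). WHAT THIS IS NOT: not Navier–Stokes evidence — a regularity theorem about
the TYPE `ClayBlowup ν` (no inhabitant is claimed anywhere) and the resulting identification of the two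
E–C types. Companion memo: `run/shared/lean/pub/ns-blowup/ecbridge2/ECBRIDGE-2-MEMO-5.md`.

## Content (closes MEMO-4 §3/§4 (i), «the one remaining gap between the types»)

* §2 Decay at spatial infinity of the two Caffarelli–Kohn–Nirenberg functionals on the boxes
  `(0, T) × B_{3/2}(x₀)`: `∫∫ (|u|³ + |p_N|^{3/2}) → 0`, `p_N = p̃[u] + Δ⁻¹∇·f` (tails of the finite slab
  integrals of `ClayBlowupSlabIntegrability.lean`; the force-potential part through
  `|b|^{3/2} ≤ δ^{3/2} + δ^{-1/2}|b|²`), and `∫∫ |f|³ → 0`.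
* §3 **`ClayBlowup.exists_farField_bound`** — for every Clay blow-up at `ν > 0` there are `R`, `M` with
  `‖u(t, x)‖ ≤ M` for `T/2 < t < T`, `|x| > R`: Lemarié-Rieusset's ε-regularity criterion WITH FORCE
  (Thm. 14.4, the tree theorem `lemarieRieusset_epsilon_regularity_holds`) on backward cylinders with
  tops `↑ T` (`IsSuitableWeakSolutionOn.farField_bound_of_ckn_decay_force_holds`) applied to the forced
  suitable weak solution `(u, p_N)` of `ClayBlowupNormalisedPressure.lean`; the essential bound is an
  everywhere bound by continuity below `T`.
* §4 **`ClayBlowup.toDesignedBlowup`** — hence EVERY Clay blow-up is a designed blow-up (g5's localized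
  bridge `toDesignedBlowupOfBoundedOutside` with `K = B̄(0, R)`): it is unbounded on the compact box and
  admits NO classical extension past `T` whatsoever; `Nonempty (DesignedBlowup ν) ↔ Nonempty (ClayBlowup ν)`;
  Fefferman's (C) `↔ ∃ ν > 0, Nonempty (DesignedBlowup ν)` `↔ ∀ ν > 0, Nonempty (DesignedBlowup ν)`.

References: P. G. Lemarié-Rieusset, *The Navier–Stokes Problem in the 21st Century* (2016), Thm. 14.4
(p. 505) and proof of Thm. 14.5 (p. 512) [cite: LemarieRieusset2016, Thm. 14.4]; L. Caffarelli, R. Kohn,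
L. Nirenberg, CPAM 35 (1982), §2 and Prop. 1 [cite: CaffarelliKohnNirenberg1982, §2]; T. Tao, Anal. PDE 6
(2013), Prop. 11.6 (uniform smoothness outside a ball — here in the uniform far-field form)
[cite: Tao2011, Prop. 11.6]; C. L. Fefferman, Clay problem description, (C) [cite: FeffermanClay2006, (C)];
J. T. Beale, T. Kato, A. Majda, CMP 94 (1984) §1 [cite: BealeKatoMajda1984, §1].
-/

noncomputable section

namespace Summit.NavierStokesRegularity.FluidComputer

open Set MeasureTheory Filter Topology Function TopologicalSpace Metric Bornology
open scoped ENNReal ContDiff NNReal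
open Literature.Analysis.FluidPDE
open Summit.NavierStokesRegularity.NavierStokesRegularity
open Summit.NavierStokesRegularity.FluidComputer.PalasekTowerClayBridge
open Summit.NavierStokesRegularity.FluidComputer.ClayForcedLerayHopf

namespace ClayBlowup

variable {ν : ℝ} (X : ClayBlowup ν)

/-! ## §2 Decay of the Caffarelli–Kohn–Nirenberg functionals at spatial infinity -/

/-- A decay box lies in the far part of the slab: for `|x₀| > n + 3/2`,
`(0, T) × B_{3/2}(x₀) ⊆ ((0, T) × ℝ³) ∩ {|x| ≥ n}`. [folklore] -/
theorem box_subset_slab_inter {T : ℝ} {n : ℝ} {x₀ : EuclideanSpace ℝ (Fin 3)} (hx₀ : n + 3 / 2 < ‖x₀‖) :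
    Ioo 0 T ×ˢ ball x₀ (3 / 2) ⊆
      (Ioo 0 T ×ˢ (univ : Set (EuclideanSpace ℝ (Fin 3)))) ∩
        {z : ℝ × EuclideanSpace ℝ (Fin 3) | n ≤ ‖z.2‖} := by
  rintro ⟨t, y⟩ ⟨ht, hy⟩
  refine ⟨⟨ht, mem_univ _⟩, ?_⟩
  rw [mem_ball, dist_eq_norm] at hy
  show n ≤ ‖y‖
  have h1 := norm_sub_norm_le x₀ y
  rw [← norm_neg (x₀ - y), neg_sub] at h1
  linarith

/-- **Decay of the velocity–pressure functional at spatial infinity**: for a Clay blow-up at `ν > 0`,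
`∫₀ᵀ ∫_{B_{3/2}(x₀)} (|u|³ + |p_N|^{3/2}) dx dt → 0` as `|x₀| → ∞`, `p_N = p̃[u] + Δ⁻¹∇·f`. The parts
`|u|³ + 2|p̃[u]|^{3/2}` and `|Δ⁻¹∇·f|²` are integrable over the slab (§1), so their box integrals are
tails of finite integrals (`exists_radius_tail_lt`); the force-potential part enters through
`|b|^{3/2} ≤ δ^{3/2} + δ^{-1/2}|b|²` with `δ` small (it is not in `L^{3/2}` at spatial infinity in
general). No named fact. [cite: LemarieRieusset2016, proof of Thm. 14.5 (p. 512)] -/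
theorem tendsto_ckn_functional_cocompact (hν : 0 < ν) :
    Tendsto (fun x₀ : EuclideanSpace ℝ (Fin 3) =>
        ∫⁻ z in Ioo 0 X.T ×ˢ ball x₀ (3 / 2),
          (‖X.u z.1 z.2‖ₑ ^ (3 : ℕ) +
            ‖normalisedPressure (X.u z.1) z.2 + forcePotential (X.f z.1) z.2‖ₑ ^ (3 / 2 : ℝ)))
      (cocompact (EuclideanSpace ℝ (Fin 3))) (𝓝 0) := by
  refine ENNReal.tendsto_nhds_zero.2 fun ε hε => ?_
  rcases eq_or_ne ε ⊤ with rfl | hεt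
  · exact Eventually.of_forall fun _ => le_top
  -- the (translation-invariant, finite) volume of a decay box
  set V : ℝ≥0∞ := volume (Ioo 0 X.T ×ˢ ball (0 : EuclideanSpace ℝ (Fin 3)) (3 / 2)) with hV
  have hVt : V ≠ ⊤ := by
    rw [hV, Measure.volume_eq_prod, Measure.prod_prod, Real.volume_Ioo]
    exact ENNReal.mul_ne_top ENNReal.ofReal_ne_top measure_ball_lt_top.ne
  have hVx : ∀ x₀ : EuclideanSpace ℝ (Fin 3), volume (Ioo 0 X.T ×ˢ ball x₀ (3 / 2)) = V := by
    intro x₀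
    rw [hV, Measure.volume_eq_prod, Measure.prod_prod, Measure.prod_prod,
      Measure.addHaar_ball_center]
  -- the threshold `δ`: `2 δ^{3/2} V ≤ ε/2`
  have hε2 : ε / 2 ≠ 0 := (ENNReal.half_pos hε.ne').ne'
  set a : ℝ≥0∞ := 2 * (V + 1) with ha
  have hat : a ≠ ⊤ := ENNReal.mul_ne_top (by norm_num) (ENNReal.add_ne_top.2 ⟨hVt, by norm_num⟩)
  set δ : ℝ≥0∞ := min 1 ((ε / 2) / a) with hδ
  have hδ1 : δ ≤ 1 := min_le_left _ _
  have hδt : δ ≠ ⊤ := ne_top_of_le_ne_top ENNReal.one_ne_top hδ1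
  have hδ0 : δ ≠ 0 := by
    rw [hδ]
    exact (lt_min one_pos (ENNReal.div_pos hε2 hat)).ne'
  have hconst : 2 * δ ^ (3 / 2 : ℝ) * V ≤ ε / 2 := by
    have h1 : δ ^ (3 / 2 : ℝ) ≤ δ := ENNReal.rpow_le_self_of_le_one hδ1 (by norm_num)
    calc 2 * δ ^ (3 / 2 : ℝ) * V ≤ 2 * δ * (V + 1) := by gcongr; exact le_self_add
      _ = a * δ := by rw [ha]; ring
      _ ≤ a * ((ε / 2) / a) := mul_le_mul' le_rfl (min_le_right _ _)
      _ ≤ ε / 2 := ENNReal.mul_div_le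
  -- the slab-integrable majorant
  set H : ℝ × EuclideanSpace ℝ (Fin 3) → ℝ≥0∞ := fun z =>
    ‖X.u z.1 z.2‖ₑ ^ (3 : ℕ) + 2 * ‖normalisedPressure (X.u z.1) z.2‖ₑ ^ (3 / 2 : ℝ) +
      2 * δ⁻¹ ^ (1 / 2 : ℝ) * ‖forcePotential (X.f z.1) z.2‖ₑ ^ 2 with hH
  have hpt : ∀ z : ℝ × EuclideanSpace ℝ (Fin 3),
      ‖X.u z.1 z.2‖ₑ ^ (3 : ℕ) +
          ‖normalisedPressure (X.u z.1) z.2 + forcePotential (X.f z.1) z.2‖ₑ ^ (3 / 2 : ℝ) ≤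
        H z + 2 * δ ^ (3 / 2 : ℝ) := by
    intro z
    have h1 := enorm_add_rpow_threeHalves_le (normalisedPressure (X.u z.1) z.2)
      (forcePotential (X.f z.1) z.2)
    have h2 := rpow_threeHalves_le_add ‖forcePotential (X.f z.1) z.2‖ₑ hδt
    calc ‖X.u z.1 z.2‖ₑ ^ (3 : ℕ) +
          ‖normalisedPressure (X.u z.1) z.2 + forcePotential (X.f z.1) z.2‖ₑ ^ (3 / 2 : ℝ)
        ≤ ‖X.u z.1 z.2‖ₑ ^ (3 : ℕ) + 2 * (‖normalisedPressure (X.u z.1) z.2‖ₑ ^ (3 / 2 : ℝ) +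
            (δ ^ (3 / 2 : ℝ) + δ⁻¹ ^ (1 / 2 : ℝ) * ‖forcePotential (X.f z.1) z.2‖ₑ ^ 2)) := by
          gcongr
          exact h1.trans (by gcongr)
      _ = H z + 2 * δ ^ (3 / 2 : ℝ) := by rw [hH]; ring
  -- `H` is integrable over the slab (slice-wise additivity, then §1)
  have hHslab : ∫⁻ z in Ioo 0 X.T ×ˢ (univ : Set (EuclideanSpace ℝ (Fin 3))), H z < ⊤ := by
    obtain ⟨c, hct, hslice⟩ := X.exists_lintegral_cube_slice_le hν
    obtain ⟨A, hAt, hA⟩ := X.energy_le hν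
    obtain ⟨Pf, hPft, hPf⟩ := clayForce_forcePotential_bounds X.force_smooth X.force_decay
    have hdis := X.lintegral_dissipation_lt_top hν
    set C₀ : ℝ≥0∞ := (steinConstThreeHalves : ℝ≥0∞) ^ (3 / 2 : ℝ) with hC₀
    have hC₀t : C₀ ≠ ⊤ := ENNReal.rpow_ne_top_of_nonneg (by norm_num) ENNReal.coe_ne_top
    set c' : ℝ≥0∞ := c + 2 * C₀ * c with hc'
    have hc't : c' ≠ ⊤ := ENNReal.add_ne_top.2 ⟨hct,
      ENNReal.mul_ne_top (ENNReal.mul_ne_top (by norm_num) hC₀t) hct⟩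
    set P' : ℝ≥0∞ := 2 * δ⁻¹ ^ (1 / 2 : ℝ) * Pf with hP'
    have hP't : P' ≠ ⊤ := ENNReal.mul_ne_top (ENNReal.mul_ne_top (by norm_num)
      (ENNReal.rpow_ne_top_of_nonneg (by norm_num) (ENNReal.inv_ne_top.2 hδ0))) hPft.ne
    refine (SereginSverak2002.lintegral_slab_le_lintegral_lintegral _ _).trans_lt ?_
    have hae : ∀ᵐ t ∂(volume.restrict (Ioo 0 X.T)), ∫⁻ x, H (t, x) ≤
        c' * (1 + ∫⁻ x, ENNReal.ofReal (frobeniusNormSq (fderiv ℝ (X.u t) x))) + P' := by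
      filter_upwards [ae_restrict_mem measurableSet_Ioo] with t htI
      have ht : t ∈ Ico 0 X.T := ⟨htI.1.le, htI.2⟩
      have hsm : ContDiff ℝ ∞ (X.u t) := X.classical.contDiff_velocity ht
      have hmem : MemLp (X.u t) 2 volume :=
        memLp_two_of_lintegral_enorm_sq_lt_top hsm.continuous.aestronglyMeasurable
          ((hA t ht).trans_lt hAt)
      have hL2 : Integrable fun y => ‖X.u t y‖ ^ 2 := hmem.integrable_norm_pow two_ne_zero
      set D : ℝ≥0∞ := ∫⁻ x, ENNReal.ofReal (frobeniusNormSq (fderiv ℝ (X.u t) x)) with hD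
      -- measurability of the first two slices
      have hm1 : AEMeasurable (fun x => ‖X.u t x‖ₑ ^ (3 : ℕ)) volume :=
        hsm.continuous.aestronglyMeasurable.enorm.pow_const _
      have hm2 : AEMeasurable
          (fun x => 2 * ‖normalisedPressure (X.u t) x‖ₑ ^ (3 / 2 : ℝ)) volume :=
        ((X.aestronglyMeasurable_normalisedPressure_slice hν ht).enorm.pow_const _).const_mul _
      -- the three slice integrals
      have e : ∫⁻ x, H (t, x) = (∫⁻ x, ‖X.u t x‖ₑ ^ (3 : ℕ)) +
          (∫⁻ x, 2 * ‖normalisedPressure (X.u t) x‖ₑ ^ (3 / 2 : ℝ)) +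
            ∫⁻ x, 2 * δ⁻¹ ^ (1 / 2 : ℝ) * ‖forcePotential (X.f t) x‖ₑ ^ 2 := by
        have hm12 : AEMeasurable (fun x => ‖X.u t x‖ₑ ^ (3 : ℕ) +
            2 * ‖normalisedPressure (X.u t) x‖ₑ ^ (3 / 2 : ℝ)) volume := hm1.add hm2
        simp only [hH]
        rw [lintegral_add_left' hm12, lintegral_add_left' hm1]
      have b1 : ∫⁻ x, ‖X.u t x‖ₑ ^ (3 : ℕ) ≤ c * (1 + D) := hslice t ht
      have b2 : ∫⁻ x, 2 * ‖normalisedPressure (X.u t) x‖ₑ ^ (3 / 2 : ℝ) ≤ 2 * C₀ * c * (1 + D) := by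
        rw [lintegral_const_mul' _ _ (by norm_num)]
        calc 2 * ∫⁻ x, ‖normalisedPressure (X.u t) x‖ₑ ^ (3 / 2 : ℝ)
            ≤ 2 * (C₀ * ∫⁻ x, ‖X.u t x‖ₑ ^ (3 : ℕ)) := by
              gcongr; exact SereginSverak2002.lintegral_normalisedPressure_rpow_le hsm hL2
          _ ≤ 2 * (C₀ * (c * (1 + D))) := by gcongr
          _ = 2 * C₀ * c * (1 + D) := by ring
      have b3 : ∫⁻ x, 2 * δ⁻¹ ^ (1 / 2 : ℝ) * ‖forcePotential (X.f t) x‖ₑ ^ 2 ≤ P' := by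
        rw [lintegral_const_mul' _ _ (ENNReal.mul_ne_top (by norm_num)
          (ENNReal.rpow_ne_top_of_nonneg (by norm_num) (ENNReal.inv_ne_top.2 hδ0))), hP']
        gcongr
        exact (hPf t ht.1).2
      rw [e]
      calc (∫⁻ x, ‖X.u t x‖ₑ ^ (3 : ℕ)) +
            (∫⁻ x, 2 * ‖normalisedPressure (X.u t) x‖ₑ ^ (3 / 2 : ℝ)) +
              ∫⁻ x, 2 * δ⁻¹ ^ (1 / 2 : ℝ) * ‖forcePotential (X.f t) x‖ₑ ^ 2
          ≤ c * (1 + D) + 2 * C₀ * c * (1 + D) + P' := add_le_add (add_le_add b1 b2) b3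
        _ = c' * (1 + D) + P' := by rw [hc']; ring
    calc ∫⁻ t in Ioo 0 X.T, ∫⁻ x, H (t, x)
        ≤ ∫⁻ t in Ioo 0 X.T,
            (c' * (1 + ∫⁻ x, ENNReal.ofReal (frobeniusNormSq (fderiv ℝ (X.u t) x))) + P') :=
          lintegral_mono_ae hae
      _ = c' * (volume (Ioo 0 X.T) +
            ∫⁻ t in Ioo 0 X.T, ∫⁻ x, ENNReal.ofReal (frobeniusNormSq (fderiv ℝ (X.u t) x))) +
            P' * volume (Ioo 0 X.T) := by
          rw [lintegral_add_right _ measurable_const, lintegral_const_mul' _ _ hc't,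
            lintegral_add_left measurable_const, setLIntegral_const, setLIntegral_const, one_mul]
      _ < ⊤ := by
          have hvol : volume (Ioo 0 X.T) < ⊤ := by rw [Real.volume_Ioo]; exact ENNReal.ofReal_lt_top
          exact ENNReal.add_lt_top.2 ⟨ENNReal.mul_lt_top hc't.lt_top
            (ENNReal.add_lt_top.2 ⟨hvol, hdis⟩), ENNReal.mul_lt_top hP't.lt_top hvol⟩
  -- tails of the finite slab integral, and the conclusion
  obtain ⟨n, hn⟩ := exists_radius_tail_lt hHslab (ENNReal.half_pos hε.ne')
  rw [← Metric.cobounded_eq_cocompact]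
  refine (Metric.hasBasis_cobounded_compl_closedBall (0 : EuclideanSpace ℝ (Fin 3))).eventually_iff.2
    ⟨(n : ℝ) + 3 / 2, trivial, fun x₀ hx₀ => ?_⟩
  rw [mem_compl_iff, mem_closedBall, dist_zero_right, not_le] at hx₀
  calc ∫⁻ z in Ioo 0 X.T ×ˢ ball x₀ (3 / 2), (‖X.u z.1 z.2‖ₑ ^ (3 : ℕ) +
          ‖normalisedPressure (X.u z.1) z.2 + forcePotential (X.f z.1) z.2‖ₑ ^ (3 / 2 : ℝ))
      ≤ ∫⁻ z in Ioo 0 X.T ×ˢ ball x₀ (3 / 2), (H z + 2 * δ ^ (3 / 2 : ℝ)) :=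
        lintegral_mono fun z => hpt z
    _ = (∫⁻ z in Ioo 0 X.T ×ˢ ball x₀ (3 / 2), H z) + 2 * δ ^ (3 / 2 : ℝ) * V := by
        rw [lintegral_add_right _ measurable_const, setLIntegral_const, hVx]
    _ ≤ ε / 2 + ε / 2 := by
        refine add_le_add ?_ hconst
        exact ((lintegral_mono_set (box_subset_slab_inter hx₀)).trans hn.le)
    _ = ε := ENNReal.add_halves ε

/-- **Decay of the force functional at spatial infinity**: `∫₀ᵀ ∫_{B_{3/2}(x₀)} |f|³ → 0` as `|x₀| → ∞`
for the Clay force of a Clay blow-up (tail of the finite slab integral of §1). No named fact.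
[cite: FeffermanClay2006, (5)] -/
theorem tendsto_force_functional_cocompact :
    Tendsto (fun x₀ : EuclideanSpace ℝ (Fin 3) =>
        ∫⁻ z in Ioo 0 X.T ×ˢ ball x₀ (3 / 2), ‖X.f z.1 z.2‖ₑ ^ (3 : ℝ))
      (cocompact (EuclideanSpace ℝ (Fin 3))) (𝓝 0) := by
  refine ENNReal.tendsto_nhds_zero.2 fun ε hε => ?_
  obtain ⟨n, hn⟩ := exists_radius_tail_lt X.lintegral_slab_force_rpow_three_lt_top hε
  rw [← Metric.cobounded_eq_cocompact]
  refine (Metric.hasBasis_cobounded_compl_closedBall (0 : EuclideanSpace ℝ (Fin 3))).eventually_iff.2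
    ⟨(n : ℝ) + 3 / 2, trivial, fun x₀ hx₀ => ?_⟩
  rw [mem_compl_iff, mem_closedBall, dist_zero_right, not_le] at hx₀
  exact ((lintegral_mono_set (box_subset_slab_inter hx₀)).trans hn.le)

/-! ## §3 The far-field bound -/

/-- **The Clay force is locally `L³` on the lifespan slab** (continuous on `[0, ∞) × ℝ³`, hence bounded
on compact subsets). [cite: FeffermanClay2006, (5)] -/
theorem memLp_force_of_isCompact {K : Set (ℝ × EuclideanSpace ℝ (Fin 3))}
    (hK : K ⊆ (slab (EuclideanSpace ℝ (Fin 3)) (Ioo 0 X.T) isOpen_Ioo :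
      Set (ℝ × EuclideanSpace ℝ (Fin 3)))) (hKc : IsCompact K) :
    MemLp (uncurry X.f) (ENNReal.ofReal 3) (volume.restrict K) := by
  obtain ⟨M, N, -, hMN⟩ := clayForce_slice_sup_L1 X.force_smooth X.force_decay
  have hKsub : K ⊆ Ici (0 : ℝ) ×ˢ (univ : Set (EuclideanSpace ℝ (Fin 3))) := fun z hz =>
    ⟨(le_of_lt (mem_slab.1 (hK hz)).1 : (0 : ℝ) ≤ z.1), mem_univ _⟩
  haveI : IsFiniteMeasure (volume.restrict K) :=
    ⟨by rw [Measure.restrict_apply_univ]; exact hKc.measure_lt_top⟩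
  have hmeas : AEStronglyMeasurable (uncurry X.f) (volume.restrict K) :=
    (X.force_smooth.continuousOn.mono hKsub).aestronglyMeasurable hKc.measurableSet
  have hbd : ∀ᵐ z ∂(volume.restrict K), ‖uncurry X.f z‖ ≤ M := by
    rw [ae_restrict_iff' hKc.measurableSet]
    exact Eventually.of_forall fun z hz => (hMN z.1 (hKsub hz).1).1 z.2
  exact (memLp_top_of_bound hmeas M hbd).mono_exponent le_top

/-- **FAR-FIELD REGULARITY UP TO THE LIFESPAN: the singularity of a Clay blow-up cannot escape to
spatial infinity.** For every Clay blow-up at `ν > 0` there are `R`, `M` with `‖u(t, x)‖ ≤ M` for all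
`T/2 < t < T` and `|x| > R`. Proof: `(u, p_N)`, `p_N = -Δ⁻¹∂ᵢ∂ⱼ(uᵢuⱼ) + Δ⁻¹∇·f`, is a suitable weak
solution WITH FORCE `f` on the open lifespan slab (`isSuitableWeakSolutionOn_normalisedPressure`); both
Caffarelli–Kohn–Nirenberg functionals decay at spatial infinity (§2); Lemarié-Rieusset's ε-regularity
criterion with force (Thm. 14.4, PROVED in the tree) on backward cylinders with tops `↑ T` gives an
essential bound on `(T/2, T) × {|x| > R}` (`farField_bound_of_ckn_decay_force_holds`), which holds
everywhere there since `u` is continuous below `T`. No named fact.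
[cite: LemarieRieusset2016, Thm. 14.4 (p. 505) with the proof of Thm. 14.5 (p. 512)]
[cite: CaffarelliKohnNirenberg1982, Prop. 1] -/
theorem exists_farField_bound (hν : 0 < ν) :
    ∃ R M : ℝ, ∀ t ∈ Ioo (X.T / 2) X.T, ∀ x : EuclideanSpace ℝ (Fin 3), R < ‖x‖ → ‖X.u t x‖ ≤ M := by
  have hT := X.T_pos
  have hsw := X.isSuitableWeakSolutionOn_normalisedPressure hν
  -- the decay hypothesis in the gauge `c = 0`
  have hdecay : Tendsto (fun x₀ : EuclideanSpace ℝ (Fin 3) =>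
      ∫⁻ z in Ioo 0 X.T ×ˢ ball x₀ (3 / 2),
        (‖X.u z.1 z.2‖ₑ ^ (3 : ℕ) +
          ‖(normalisedPressure (X.u z.1) z.2 + forcePotential (X.f z.1) z.2) -
              (fun (_ : EuclideanSpace ℝ (Fin 3)) (_ : ℝ) => (0 : ℝ)) x₀ z.1‖ₑ ^ (3 / 2 : ℝ)))
      (cocompact (EuclideanSpace ℝ (Fin 3))) (𝓝 0) := by
    simp only [sub_zero]
    exact X.tendsto_ckn_functional_cocompact hν
  obtain ⟨R, hR⟩ := hsw.farField_bound_of_ckn_decay_force_holds hν (q := 3) (by norm_num)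
    (fun K hK hKc => X.memLp_force_of_isCompact hK hKc)
    (c := fun (_ : EuclideanSpace ℝ (Fin 3)) (_ : ℝ) => (0 : ℝ)) (fun _ => MemLp.zero) hdecay
    X.tendsto_force_functional_cocompact (t₁ := X.T / 2) (t₂ := X.T) (by positivity) le_rfl
  -- from the essential bound to a pointwise bound on the open far region
  set W : Set (ℝ × EuclideanSpace ℝ (Fin 3)) :=
    Ioo (X.T / 2) X.T ×ˢ (closedBall (0 : EuclideanSpace ℝ (Fin 3)) R)ᶜ with hW
  have hWo : IsOpen W := isOpen_Ioo.prod isClosed_closedBall.isOpen_compl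
  set M : ℝ := (eLpNorm (uncurry X.u) ∞
    ((volume : Measure (ℝ × EuclideanSpace ℝ (Fin 3))).restrict W)).toReal with hM
  have hae : ∀ᵐ z ∂((volume : Measure (ℝ × EuclideanSpace ℝ (Fin 3))).restrict W),
      ‖uncurry X.u z‖ ≤ M := by
    have h1 := ae_le_eLpNormEssSup
      (μ := (volume : Measure (ℝ × EuclideanSpace ℝ (Fin 3))).restrict W) (f := uncurry X.u)
    filter_upwards [h1] with z hz
    rw [hM, eLpNorm_exponent_top]
    rw [eLpNorm_exponent_top] at hR
    exact (toReal_enorm (uncurry X.u z)) ▸ ENNReal.toReal_mono hR.ne hz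
  have hcont : ContinuousOn (uncurry X.u) W :=
    X.classical.smooth_velocity.continuousOn.mono fun z hz =>
      ⟨⟨by linarith [hz.1.1], hz.1.2⟩, mem_univ _⟩
  have hall := SereginSverak2002.norm_le_of_ae_restrict_of_continuousOn hWo hcont hae
  refine ⟨R, M, fun t ht x hx => hall (t, x) ⟨ht, ?_⟩⟩
  rw [mem_compl_iff, mem_closedBall, dist_zero_right, not_le]
  exact hx

/-! ## §4 `ClayBlowup ν → DesignedBlowup ν` and the identification of the two E–C types -/

/-- **EVERY CLAY BLOW-UP IS A DESIGNED BLOW-UP** (`ν > 0`): by far-field regularity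
(`exists_farField_bound`) the velocity is bounded outside the compact ball `B̄(0, R)` on `[3T/4, T)`,
so it is unbounded ON the ball and admits NO classical extension past `T` whatsoever
(`toDesignedBlowupOfBoundedOutside`, g5). This closes the one gap between the weakest E–C type
(Leray's époque d'irrégularité for Clay data with a Clay force) and the designed blow-up of the
construction lanes. No named fact. [cite: FeffermanClay2006, (C)] [cite: BealeKatoMajda1984, §1] -/
def toDesignedBlowup (hν : 0 < ν) : DesignedBlowup ν :=
  X.toDesignedBlowupOfBoundedOutside hν (isCompact_closedBall (0 : EuclideanSpace ℝ (Fin 3))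
    (Classical.choose (X.exists_farField_bound hν)))
    (t₀ := 3 * X.T / 4) (M := Classical.choose (Classical.choose_spec (X.exists_farField_bound hν)))
    (by linarith [X.T_pos]) (fun t ht x hx =>
      Classical.choose_spec (Classical.choose_spec (X.exists_farField_bound hν)) t
        ⟨by linarith [ht.1, X.T_pos], ht.2⟩ x (by
          rw [mem_closedBall, dist_zero_right, not_le] at hx
          exact hx))

/-- The designed blow-up of a Clay blow-up has the same velocity. [folklore] -/
theorem toDesignedBlowup_u (hν : 0 < ν) : (X.toDesignedBlowup hν).u = X.u := rfl

/-- The designed blow-up of a Clay blow-up has the same lifespan. [folklore] -/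
theorem toDesignedBlowup_T (hν : 0 < ν) : (X.toDesignedBlowup hν).T = X.T := rfl

/-- The designed blow-up of a Clay blow-up has the same force. [folklore] -/
theorem toDesignedBlowup_f (hν : 0 < ν) : (X.toDesignedBlowup hν).f = X.f := rfl

/-- **A Clay blow-up admits NO classical extension past its lifespan** — not only no finite-energy
one (`ν > 0`). [cite: BealeKatoMajda1984, §1] -/
theorem not_hasSmoothExtensionPast (hν : 0 < ν) : ¬ HasSmoothExtensionPast ν X.f X.u X.T :=
  (X.toDesignedBlowup hν).no_extension

/-- **A Clay blow-up is a maximal smooth solution with lifespan `T`** (Beale–Kato–Majda vocabulary;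
`ν > 0`). [cite: BealeKatoMajda1984, §1] -/
theorem isMaximalSmoothSolution (hν : 0 < ν) : IsMaximalSmoothSolution ν X.f X.u X.p X.T :=
  ⟨X.classical, X.not_hasSmoothExtensionPast hν⟩

/-- **A Clay blow-up is UNBOUNDED ON A COMPACT BOX**: there is `R` with
`sup {‖u(t, x)‖ : 0 ≤ t < T, |x| ≤ R} = ∞` (`ν > 0`). [cite: LemarieRieusset2016, Thm. 11.2] -/
theorem exists_unboundedOn_closedBall (hν : 0 < ν) :
    ∃ R : ℝ, ∀ M' : ℝ, ∃ t ∈ Ico 0 X.T, ∃ x ∈ closedBall (0 : EuclideanSpace ℝ (Fin 3)) R,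
      M' < ‖X.u t x‖ := by
  obtain ⟨R, M, h⟩ := X.exists_farField_bound hν
  refine ⟨R, X.unboundedOn_of_bounded_outside hν (t₀ := 3 * X.T / 4) (M := M)
    (by linarith [X.T_pos]) fun t ht x hx => h t ⟨by linarith [ht.1, X.T_pos], ht.2⟩ x ?_⟩
  rw [mem_closedBall, dist_zero_right, not_le] at hx
  exact hx

end ClayBlowup

/-- **THE TWO E–C TYPES ARE EQUALLY INHABITED**: at every `ν > 0`, `DesignedBlowup ν` is inhabited iff
`ClayBlowup ν` is (`DesignedBlowup.toClayBlowup`, `ClayBlowup.toDesignedBlowup`).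
[cite: FeffermanClay2006, (C)] -/
theorem nonempty_designedBlowup_iff_nonempty_clayBlowup {ν : ℝ} (hν : 0 < ν) :
    Nonempty (DesignedBlowup ν) ↔ Nonempty (ClayBlowup ν) :=
  ⟨fun ⟨D⟩ => ⟨D.toClayBlowup⟩, fun ⟨X⟩ => ⟨X.toDesignedBlowup hν⟩⟩

/-- **FEFFERMAN'S (C) ⟺ A DESIGNED BLOW-UP EXISTS AT SOME VISCOSITY**: `NavierStokesBreakdownR3 ↔
∃ ν > 0, Nonempty (DesignedBlowup ν)` (g5's `navierStokesBreakdownR3_iff_exists_nonempty_clayBlowup` and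
the identification of the types). Neither side is asserted. [cite: FeffermanClay2006, (C)] -/
theorem navierStokesBreakdownR3_iff_exists_nonempty_designedBlowup :
    NavierStokesRegularity.NavierStokesBreakdownR3 ↔ ∃ ν : ℝ, 0 < ν ∧ Nonempty (DesignedBlowup ν) := by
  rw [navierStokesBreakdownR3_iff_exists_nonempty_clayBlowup]
  constructor
  · rintro ⟨ν, hν, h⟩
    exact ⟨ν, hν, (nonempty_designedBlowup_iff_nonempty_clayBlowup hν).2 h⟩
  · rintro ⟨ν, hν, h⟩
    exact ⟨ν, hν, (nonempty_designedBlowup_iff_nonempty_clayBlowup hν).1 h⟩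

/-- **FEFFERMAN'S (C) ⟺ A DESIGNED BLOW-UP EXISTS AT EVERY VISCOSITY.** Neither side is asserted.
[cite: FeffermanClay2006, (C)] -/
theorem navierStokesBreakdownR3_iff_forall_nonempty_designedBlowup :
    NavierStokesRegularity.NavierStokesBreakdownR3 ↔ ∀ ν : ℝ, 0 < ν → Nonempty (DesignedBlowup ν) := by
  rw [navierStokesBreakdownR3_iff_forall_nonempty_clayBlowup]
  constructor
  · intro h ν hν
    exact (nonempty_designedBlowup_iff_nonempty_clayBlowup hν).2 (h ν hν)
  · intro h ν hν
    exact (nonempty_designedBlowup_iff_nonempty_clayBlowup hν).1 (h ν hν)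

end Summit.NavierStokesRegularity.FluidComputer

end
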